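import Summits.BirchSwinnertonDyer.BirchSwinnertonDyer.Theorems.AdditiveBranchIMCMultLowerCongruenceCert
import Summits.BirchSwinnertonDyer.Rank1Residual.X9.HessePartnerTransport
import Summits.BirchSwinnertonDyer.Rank1Residual.GaloisImage.TorsionIsoImageObstruction
import Summits.BirchSwinnertonDyer.Rank1Residual.Additive.GordRankZeroChiBranch
import Summits.BirchSwinnertonDyer.Rank1Residual.Additive.QuadraticTwistSurj
import Literature.NumberTheory.EllipticCurves.Kato2004.Condition1252SemistableProofs
import HarnessLib

/-!
# Crux `MultLower` (item 19359) / child `MultLambdaLower` (item 19590), the EPW branch road on cell (M):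
# ONE twist model and ONE partner suffice; the partner's tower-surjectivity is AUTOMATIC on the surjective
# rows; and the `p = 5` shape with the congruence (C1) a THEOREM (Fisher's Hesse pencil) — sequel of
# `AdditiveBranchIMCMultLowerCongruence{,Cert}`

Cell `bsd-addord`, seat `bsd-addord-k1-c4` (D-0074 row B3), gen 3. HONEST FRAMING as in the parent files:
theorems only; every published input is a named-fact binder (`hKW` Kato/Wuthrich half-eigen divisibility,
`hEPW` Emerton–Pollack–Weston Cor. 5.1.4 between semistable members, `hF` Fisher 2012 Thm. 13.2, the
route's facts `hDelX hPal hGZK hmod hmodD`); the per-pair data are displayed binders, never asserted;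
nothing is booked; BSD is not proved here.

WHAT THIS FILE REMOVES FROM THE PARTNER DEMAND of `…CongruenceCert` §3
(`missingLowerBoundAt_rankZero_of_cellM_of_partner_LValueUnit`):
* §1 the ∀ over twist models — any two globally minimal `V, V′` with `C • V^{(d)} = W = C′ • V′^{(d)}` are
  related by a change of variables over `ℚ` (twist involution, tree
  `exists_variableChange_twist_of_model_twist`), so `V[p] ≅ V′[p]` `Γ_ℚ`-equivariantly
  (`exists_geomTorsion_addEquiv_smul`) and ONE isomorphism `V₁[p] ≅ V₀[p]` serves every model;
* §2 the partner's image hypothesis — on the rows with `ρ̄_{E,p}` onto (the X4(M)-surj rows, the only ones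
  the road reaches anyway): `Surj E p ⟺ Surj V₀ p` (twist, `surj_iff_of_model_twist`) `⟹ Surj V₁ p`
  (congruence, `hasSurjectiveModNGaloisRep_iff_of_torsionIso`) `⟹ ρ_{V₁,pⁿ}` onto for all `n` (semistable
  partner, Serre / Wuthrich Lemma 20, tree theorem `forall_hasSurjectiveModNGaloisRep_pow_of_semistable_of_surj`);
* §3 at `p = 5`, the isomorphism itself — a curve `ℚ`-isomorphic to a member `E_{l,m}` of Fisher's Hesse
  pencil of `V₀` IS `5`-congruent to `V₀` (Fisher, Proc. LMS 104 (2012) Thm. 13.2, tree fact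
  `Fisher2012.thm132_fiveCongruent_hessePencil`, consumer `X9.torsionIso_of_hessePencil5` of cell x9), so
  (C1) becomes two rational numbers `(l, m)` and an explicit change of variables, decided by `norm_num` in a
  per-pair record exactly as in `X9/HessePartnerRecords*.lean`.
So on an X4(M)-surj rank-`0` pair `(E, 5)` the lower half `ord_5 #Ш(E)_an ≤ ord_5 #Ш(E)` follows from the
named facts and: a multiplicative twist model `V₀` (`C₀ • V₀^{(5)} = E`), a partner `V₁` good ordinary or
multiplicative at `5` that is (a `ℚ`-model of) a Hesse-pencil member of `V₀`, and its additive `5`-twist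
`E₁` of analytic rank `0` with `ord_5 (L(E₁,1)/Ω_{E₁}) = 0` — ALL decidable / finite data
(`missingLowerBoundAt_rankZero_of_cellM_surj_of_hessePartner_five`). The clientele and its limits
(`λ(ρ̄, ω²)` minimal must vanish; `μ = 0`) are EPW's (§5 of the paper); finding `(l, m)` is engine work.

References: Emerton–Pollack–Weston 2006 Cor. 5.1.4, Ex. 5.3.1 [EmertonPollackWeston2006]; Fisher 2012
Thm. 13.2 [Fisher2012Hessian]; Serre 1968 IV-23 [SerreAbelianLadic1968]; Wuthrich 2014 Lemma 20, Thm. 3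
[Wuthrich2014]; Kato 2004 Thm. 12.5 (4) [Kato2004Asterisque]; Silverman AEC X.5 Cor. 5.4, III §1
[SilvermanAEC2009]; Pal 2012 Thm. 3.2 [Pal2012]; Delbourgo 1998 Prop. 4 [Delbourgo1998]; Miller 2011
Def. 1.1 [Miller2011LMS].
-/

set_option autoImplicit false
set_option linter.dupNamespace false

noncomputable section

open scoped Classical MatrixGroups ModularForm

open CongruenceSubgroup WeierstrassCurve
  Literature.NumberTheory.EllipticCurves
  Literature.NumberTheory.EllipticCurves.ModularForms
  Literature.NumberTheory.EllipticCurves.Rank1Residual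
  Literature.NumberTheory.EllipticCurves.Rank1Residual.Typed
  Literature.NumberTheory.EllipticCurves.GreenbergVatsal2000
  Literature.NumberTheory.EllipticCurves.EmertonPollackWeston2006
  Literature.NumberTheory.EllipticCurves.Fisher2012
  Literature.NumberTheory.GaloisRepresentations

namespace Summit.BirchSwinnertonDyer.BirchSwinnertonDyer.Theorems.AdditiveBranchIMCMultLowerCongruence

open Summit.BirchSwinnertonDyer.Rank1Residual
open Summit.BirchSwinnertonDyer.Rank1Residual.Additive
open Summit.BirchSwinnertonDyer.Rank1Residual.AdditivePotMult
open Summit.BirchSwinnertonDyer.Rank1Residual.GaloisImage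
open Summit.BirchSwinnertonDyer.BirchSwinnertonDyer.Theses.AdditiveBranchIMC
open Summit.BirchSwinnertonDyer.BirchSwinnertonDyer.Theorems.AdditiveBranchIMCMultLower

variable {p : ℕ} [hp : Fact p.Prime]

/-! ## §1 Two twist models of the same curve have `Γ_ℚ`-isomorphic torsion -/

/-- **Two `ℚ`-models of the same twist have `Γ_ℚ`-isomorphic `n`-torsion.** If `C₀ • V₀^{(d)} = W` and
`C • V^{(d)} = W` (`d ≠ 0`) then `V = C′ • V₀` for a change of variables `C′` over `ℚ` (twist involution on
models, `exists_variableChange_twist_of_model_twist`, twice), whence a `Γ_ℚ`-equivariant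
`V₀[n] ≃ V[n]` (`exists_geomTorsion_addEquiv_smul`). [cite: SilvermanAEC2009, X.5 Cor. 5.4, III §1] -/
theorem exists_torsionIso_of_model_twist_of_model_twist {W V₀ V : WeierstrassCurve ℚ} {d : ℚ}
    (hd : d ≠ 0) {C₀ C : VariableChange ℚ} (hC₀ : C₀ • V₀.quadraticTwist d = W)
    (hC : C • V.quadraticTwist d = W) (n : ℤ) :
    ∃ e : geomTorsion V₀ n ≃+ geomTorsion V n,
      ∀ (σ : Field.absoluteGaloisGroup ℚ) (P : geomTorsion V₀ n), e (σ • P) = σ • e P := by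
  obtain ⟨C₀', hC₀'⟩ := exists_variableChange_twist_of_model_twist V₀ hd hC₀
  obtain ⟨C', hC'⟩ := exists_variableChange_twist_of_model_twist V hd hC
  have hV : (C' * C₀'⁻¹) • V₀ = V := by
    rw [← hC₀', smul_smul, mul_assoc, inv_mul_cancel, mul_one, hC']
  rw [← hV]
  exact exists_geomTorsion_addEquiv_smul V₀ (C' * C₀'⁻¹) n

/-- **ONE isomorphism serves every twist model**: from `C₀ • V₀^{(d)} = W` and a `Γ_ℚ`-equivariant
`V₁[n] ≃ V₀[n]`, every `V` with `C • V^{(d)} = W` carries a `Γ_ℚ`-equivariant `V₁[n] ≃ V[n]`.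
[cite: SilvermanAEC2009, X.5 Cor. 5.4, III §1] -/
theorem torsionIso_models_of_one {W V₀ V₁ : WeierstrassCurve ℚ} {d : ℚ} (hd : d ≠ 0)
    {C₀ : VariableChange ℚ} (hC₀ : C₀ • V₀.quadraticTwist d = W) {n : ℤ}
    (h₁ : ∃ e : geomTorsion V₁ n ≃+ geomTorsion V₀ n,
      ∀ (σ : Field.absoluteGaloisGroup ℚ) (P : geomTorsion V₁ n), e (σ • P) = σ • e P)
    (V : WeierstrassCurve ℚ) (hCW : ∃ C : VariableChange ℚ, C • V.quadraticTwist d = W) :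
    ∃ e : geomTorsion V₁ n ≃+ geomTorsion V n,
      ∀ (σ : Field.absoluteGaloisGroup ℚ) (P : geomTorsion V₁ n), e (σ • P) = σ • e P := by
  obtain ⟨C, hC⟩ := hCW
  obtain ⟨e₁, he₁⟩ := h₁
  obtain ⟨e₂, he₂⟩ := exists_torsionIso_of_model_twist_of_model_twist hd hC₀ hC n
  exact ⟨e₁.trans e₂, fun σ P ↦ by rw [AddEquiv.trans_apply, AddEquiv.trans_apply, he₁, he₂]⟩

/-! ## §2 The partner's tower-surjectivity is automatic on the surjective rows -/

/-- **`ρ_{V₁,pⁿ}` onto for all `n`, for a semistable partner of a twist model of a curve with `ρ̄_{E,p}`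
onto** (`p` odd): `Surj E p ⟹ Surj V₀ p` (`surj_iff_of_model_twist`) `⟹ Surj V₁ p` along the
`Γ_ℚ`-equivariant `V₁[p] ≃ V₀[p]` (`hasSurjectiveModNGaloisRep_iff_of_torsionIso`) `⟹` the tower (Serre's
lifting lemma for `p ≥ 5`, Wuthrich 2014 Lemma 20 at a semistable `3`; tree theorem
`forall_hasSurjectiveModNGaloisRep_pow_of_semistable_of_surj`).
[cite: SerreAbelianLadic1968, Ch. IV §3.4, Lemma 3 (IV-23)] [cite: Wuthrich2014, Lemma 20 (p. 399)] -/
theorem towerSurj_partner_of_surj {W V₀ V₁ : WeierstrassCurve ℚ} [W.IsElliptic] [W.IsGloballyMinimal]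
    [V₀.IsElliptic] [V₀.IsGloballyMinimal] [V₁.IsElliptic] [V₁.IsGloballyMinimal] (hp2 : p ≠ 2) {d : ℚ}
    (hd : d ≠ 0)
    (hCW : ∃ C : VariableChange ℚ, C • V₀.quadraticTwist d = W) (hsW : Surj W p)
    (hred₁ : IsOrdinaryAt V₁ p ∨ V₁.HasMultiplicativeReductionAtPrime p)
    (h₁ : ∃ e : geomTorsion V₁ (p : ℤ) ≃+ geomTorsion V₀ (p : ℤ),
      ∀ (σ : Field.absoluteGaloisGroup ℚ) (P : geomTorsion V₁ (p : ℤ)), e (σ • P) = σ • e P) (n : ℕ) :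
    V₁.HasSurjectiveModNGaloisRep (p ^ n : ℕ) := by
  have hsV₀ : Surj V₀ p := (surj_iff_of_model_twist V₀ p hd hCW).mp hsW
  obtain ⟨e, he⟩ := h₁
  have hsV₁ : Surj V₁ p := (hasSurjectiveModNGaloisRep_iff_of_torsionIso e he).mpr hsV₀
  have hred : V₁.HasGoodReductionAtPrime p ∨ V₁.HasMultiplicativeReductionAtPrime p := by
    rcases hred₁ with h | h
    · exact Or.inl h.1
    · exact Or.inr h
  exact V₁.forall_hasSurjectiveModNGaloisRep_pow_of_semistable_of_surj p hp2 hred hsV₁ n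

/-- **Cell (M) with `ρ̄_{E,p}` onto, `p ≥ 5`, `r_an(E) = 0`: the lower half from ONE twist model, ONE
congruence and the partner's (C2′) — no image hypothesis on the partner, no ∀ over models.** Facts:
`hDelX hPal hGZK hmod hmodD hKW hEPW`. Data: `C₀ • V₀^{(p*)} = E`; the partner `V₁` (good ordinary or
multiplicative at `p`) with a `Γ_ℚ`-equivariant `V₁[p] ≃ V₀[p]` ((C1), one model) and its globally minimal
`p*`-twist `E₁`, additive at `p`, of analytic rank `0` with `ord_p (L(E₁,1)/Ω_{E₁}) = 0` ((C2′)). Via §1, §2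
and `…CongruenceCert` §3. CONDITIONAL on the displayed facts and data; closes nothing.
[cite: EmertonPollackWeston2006, Cor. 5.1.4 (arXiv p30), Ex. 5.3.1 (p32)] [cite: Kato2004Asterisque, Thm. 12.5 (4) (p. 222)]
[cite: Pal2012, Thm. 3.2] [cite: Delbourgo1998, Prop. 4 (p. 144), §2.2 Lemma (ii) (p. 139)] [cite: Miller2011LMS, Def. 1.1] -/
theorem missingLowerBoundAt_rankZero_of_cellM_surj_of_partner_LValueUnit {W : WeierstrassCurve ℚ}
    [W.IsElliptic] [W.IsGloballyMinimal]
    (hDelX : Delbourgo1998.prop4_rankZero_constantCoeff_eq_unit_mul_of_potMult)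
    (hPal : Pal2012.thm32_sqrt_mul_realPeriodRat_twist_eq_of_prime_one_mod_four)
    (hGZK : rank_eq_analyticRank_of_analyticRank_le_one) (hmod : hasEntireLFunction_rat)
    (hmodD : nonempty_modularParametrizationData)
    (hKW : Wuthrich2014.kato_halfEigenCharIdeal_dvd_cyclotomicPrime_of_surjective)
    (hEPW : EmertonPollackWeston2006.cor514_branchTransfer_semistable_of_torsionIso)
    (hc : N10.CellM W p) (hsW : Surj W p) (hp5 : 5 ≤ p) (hr : W.analyticRank = 0)
    (V₀ : WeierstrassCurve ℚ) [V₀.IsElliptic] [V₀.IsGloballyMinimal] (C₀ : VariableChange ℚ)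
    (hC₀ : C₀ • V₀.quadraticTwist ((-1) ^ (p / 2) * p : ℚ) = W)
    (V₁ E₁ : WeierstrassCurve ℚ) [V₁.IsElliptic] [V₁.IsGloballyMinimal] [E₁.IsElliptic]
    [E₁.IsGloballyMinimal]
    (hiso₁ : ∃ e : geomTorsion V₁ (p : ℤ) ≃+ geomTorsion V₀ (p : ℤ),
      ∀ (σ : Field.absoluteGaloisGroup ℚ) (P : geomTorsion V₁ (p : ℤ)), e (σ • P) = σ • e P)
    (hred₁ : IsOrdinaryAt V₁ p ∨ V₁.HasMultiplicativeReductionAtPrime p)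
    (hCW₁ : ∃ C : VariableChange ℚ, C • V₁.quadraticTwist ((-1) ^ (p / 2) * p : ℚ) = E₁)
    (hadd₁ : Addv E₁ p) (hr₁ : E₁.analyticRank = 0)
    (hL₁ : ∃ q : ℚ, E₁.entireLFunction 1 = (q : ℂ) * (E₁.realPeriodRat : ℂ) ∧ padicValRat p q = 0) :
    MissingLowerBoundAt W p := by
  have hp2 : p ≠ 2 := by omega
  have hd : ((-1) ^ (p / 2) * p : ℚ) ≠ 0 :=
    mul_ne_zero (pow_ne_zero _ (by norm_num)) (Nat.cast_ne_zero.mpr hp.out.ne_zero)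
  exact missingLowerBoundAt_rankZero_of_cellM_of_partner_LValueUnit hDelX hPal hGZK hmod hmodD hKW hEPW hc
    hp5 hr V₁ E₁ hCW₁ hred₁ (towerSurj_partner_of_surj hp2 hd ⟨C₀, hC₀⟩ hsW hred₁ hiso₁) hadd₁ hr₁ hL₁
    (fun V _ _ hCW ↦ torsionIso_models_of_one hd hC₀ hiso₁ V hCW)

/-! ## §3 `p = 5`: the congruence (C1) is a theorem for a Hesse-pencil member (Fisher 2012 Thm. 13.2) -/

/-- **Cell (M) at `p = 5` with `ρ̄_{E,5}` onto, `r_an(E) = 0`: `ord_5 #Ш(E)_an ≤ ord_5 #Ш(E)` from the named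
facts and FINITE per-pair data — the shape a booking at `5` instantiates.** Facts: `hDelX hPal hGZK hmod
hmodD` (route), `hKW` (Kato/Wuthrich half-eigen divisibility), `hEPW` (EPW Cor. 5.1.4, semistable
members), `hF` (Fisher 2012 Thm. 13.2: every non-singular member of the Hesse pencil of `V₀` is
`5`-congruent to `V₀`). Data: a multiplicative twist model `V₀` with `C₀ • V₀^{(5)} = E`; a PARTNER `V₁`, good
ordinary or multiplicative at `5`, `ℚ`-isomorphic to the pencil member `E_{l,m}` of `V₀`
(`hC₁ : C₁ • V₁ = hessePencil5 V₀.c₄ V₀.c₆ l m`, decided by `norm_num` on the two evaluated Hesse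
covariants in a record); its globally minimal `5`-twist `E₁`, additive at `5`, of analytic rank `0` with
`ord_5 (L(E₁,1)/Ω_{E₁}) = 0`. Then the lower half of `BSD(E,5)` holds. Reach: `λ(ρ̄, ω²) = 0` and `μ = 0`
(EPW §5); CONDITIONAL on the displayed facts and data; closes nothing by itself.
[cite: Fisher2012Hessian, Thm. 13.2] [cite: EmertonPollackWeston2006, Cor. 5.1.4 (arXiv p30), Ex. 5.3.1 (p32)]
[cite: Kato2004Asterisque, Thm. 12.5 (4) (p. 222)] [cite: Pal2012, Thm. 3.2]
[cite: Delbourgo1998, Prop. 4 (p. 144), §2.2 Lemma (ii) (p. 139)] [cite: Miller2011LMS, Def. 1.1] -/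
theorem missingLowerBoundAt_rankZero_of_cellM_surj_of_hessePartner_five [Fact (Nat.Prime 5)]
    {W : WeierstrassCurve ℚ} [W.IsElliptic] [W.IsGloballyMinimal]
    (hDelX : Delbourgo1998.prop4_rankZero_constantCoeff_eq_unit_mul_of_potMult)
    (hPal : Pal2012.thm32_sqrt_mul_realPeriodRat_twist_eq_of_prime_one_mod_four)
    (hGZK : rank_eq_analyticRank_of_analyticRank_le_one) (hmod : hasEntireLFunction_rat)
    (hmodD : nonempty_modularParametrizationData)
    (hKW : Wuthrich2014.kato_halfEigenCharIdeal_dvd_cyclotomicPrime_of_surjective)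
    (hEPW : EmertonPollackWeston2006.cor514_branchTransfer_semistable_of_torsionIso)
    (hF : thm132_fiveCongruent_hessePencil)
    (hc : N10.CellM W 5) (hsW : Surj W 5) (hr : W.analyticRank = 0)
    (V₀ : WeierstrassCurve ℚ) [V₀.IsElliptic] [V₀.IsGloballyMinimal] (C₀ : VariableChange ℚ)
    (hC₀ : C₀ • V₀.quadraticTwist (5 : ℚ) = W)
    (V₁ E₁ : WeierstrassCurve ℚ) [V₁.IsElliptic] [V₁.IsGloballyMinimal] [E₁.IsElliptic]
    [E₁.IsGloballyMinimal] (l m : ℚ) (C₁ : VariableChange ℚ)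
    (hC₁ : C₁ • V₁ = hessePencil5 V₀.c₄ V₀.c₆ l m)
    (hred₁ : IsOrdinaryAt V₁ 5 ∨ V₁.HasMultiplicativeReductionAtPrime 5)
    (hCW₁ : ∃ C : VariableChange ℚ, C • V₁.quadraticTwist (5 : ℚ) = E₁)
    (hadd₁ : Addv E₁ 5) (hr₁ : E₁.analyticRank = 0)
    (hL₁ : ∃ q : ℚ, E₁.entireLFunction 1 = (q : ℂ) * (E₁.realPeriodRat : ℂ) ∧ padicValRat 5 q = 0) :
    MissingLowerBoundAt W 5 := by
  have h5 : ((-1) ^ (5 / 2) * 5 : ℚ) = 5 := by norm_num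
  have hC₀' : C₀ • V₀.quadraticTwist ((-1) ^ (5 / 2) * 5 : ℚ) = W := by rw [h5]; exact hC₀
  have hCW₁' : ∃ C : VariableChange ℚ, C • V₁.quadraticTwist ((-1) ^ (5 / 2) * 5 : ℚ) = E₁ := by
    rw [h5]; exact hCW₁
  exact missingLowerBoundAt_rankZero_of_cellM_surj_of_partner_LValueUnit hDelX hPal hGZK hmod hmodD hKW hEPW
    hc hsW (le_refl 5) hr V₀ C₀ hC₀' V₁ E₁ (X9.torsionIso_of_hessePencil5 hF V₀ V₁ l m C₁ hC₁) hred₁ hCW₁'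
    hadd₁ hr₁ hL₁

end Summit.BirchSwinnertonDyer.BirchSwinnertonDyer.Theorems.AdditiveBranchIMCMultLowerCongruence

end
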